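import Mathlib.Combinatorics.SimpleGraph.Maps
import Mathlib.Data.Fintype.Pi
import Mathlib.Data.Fin.Tuple.Basic
import Literature.ModelTheory.FiniteModelTheory.CkEquiv
import HarnessLib

/-!
# The `k`-dimensional Weisfeiler–Leman refinement and its equivalence with `≡_{C^{k+1}}` (named
fact)

Topic `Literature/ModelTheory/FiniteModelTheory`; follow-up to definition requests `defn-CkEquiv`
/ `defn-CountingWidth` ("pick ONE rendering of `≡_{C^k}` — `C^k_{∞ω}`-equivalence, the bijective
`k`-pebble game, or `(k-1)`-dimensional Weisfeiler–Leman indistinguishability — and record the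
others as named equivalence facts"). The game is the tree's definition (`CkEquiv.lean`); the
logic and Hella's theorem are in `CountingLogic.lean` (proved); this file DEFINES `k`-WL exactly
as printed in Dell–Grohe–Rattan 2018, §8 (the version of Cai–Fürer–Immerman 1992, §5) and records
the Immerman–Lander / Cai–Fürer–Immerman equivalence `k`-WL ≡ `C^{k+1}` as a NAMED FACT.

* `atp G v̄` — the ATOMIC TYPE of a `k`-tuple: the matrix `A ∈ {0,1,2}^{k×k}` with `A i j = 2` if
  `vᵢ = vⱼ`, `1` if `vᵢ ~ vⱼ`, `0` otherwise (DGR display `A_{ij} = 2` "if `i = j`"; their "crucial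
  property" — equal atomic types iff `{(vᵢ, wᵢ)}` is a partial isomorphism, `atp_eq_atp_iff` —
  fixes the reading `vᵢ = vⱼ` for tuples with repeated entries, which we take).
* `WLColour k i` — the CANONICAL colours of round `i` (nested multisets, so that colours of
  different graphs are comparable without "decoding tables"): `C₀ = atp`,
  `C_{i+1}(v̄) = (C_i(v̄), {{ (atp(v̄, w), (C_i(v̄[j ↦ w]))_{j < k}) | w ∈ V }})`
  (`wlColour`; DGR list the substituted tuples as `v̄[k ↦ w], …, v̄[1 ↦ w]`, we index them by the
  substituted position `j` — the same data).
* `WLEquiv k G H` — `k`-WL does NOT distinguish `G` and `H`: for every round `i` the multisets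
  `{{C_i(G; v̄) | v̄ ∈ V(G)^k}}` and `{{C_i(H; w̄) | w̄ ∈ V(H)^k}}` coincide. (DGR compare the
  stable colourings `C_∞`; agreement at every round is the form proved equivalent to
  `≡_{C^{k+1}}` round by round in Cai–Fürer–Immerman 1992, Thm 5.2, and implies agreement of the
  stable colourings; we take the every-round form as the definition and say so.)
* PROVED: `atp_eq_atp_iff` (atomic types vs partial isomorphisms, DGR's "crucial property"),
  invariance of colours under isomorphisms (`wlColour_comp_iso`) hence `WLEquiv.of_iso`,
  `WLEquiv.refl`, `WLEquiv.symm`, and `WLEquiv.card_eq` (`k ≥ 1`).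
* NAMED FACT `immermanLander_wlEquiv_iff_ckEquiv`: for `k ≥ 1` and finite graphs on `Fin n`,
  `Fin m`, `WLEquiv k G H ↔ CkEquiv (k + 1) G H` (Dell–Grohe–Rattan 2018, Lemma 12
  [Immerman–Lander 1990]; Cai–Fürer–Immerman 1992, Thm 5.2; with Hella's theorem for the game
  form of `≡_{C^{k+1}}`).

## References

* H. Dell, M. Grohe, G. Rattan, *Lovász meets Weisfeiler and Leman*, ICALP 2018
  (arXiv:1802.08876), §8: atomic types, `k`-WL, "k-WL distinguishes G and H", Lemma 12. Read p. 14.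
* J.-Y. Cai, M. Fürer, N. Immerman, *An optimal lower bound on the number of variables for graph
  identification*, Combinatorica 12 (1992), §5 (k-dim W-L: initial colour = isomorphism type of
  the tuple; refinement by `sift`), Thm 5.2. Read (FOCS 1989 version) pp. 12–14.
* N. Immerman, E. Lander, *Describing graphs: a first-order approach to graph canonization*, in:
  Complexity Theory Retrospective, Springer 1990 (the `k = 1` case and the logics `C^k`).
* A. Dawar, G. Wilsenach, *Symmetric arithmetic circuits*, Theory of Computing 21 (2025), §2.4
  (`≡ₖ` = `k`-WL equivalence = `(k+1)`-variable counting logic).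
-/

namespace Literature.ModelTheory.FiniteModelTheory

universe u v

variable {V : Type u} {W : Type v}

/-! ### Atomic types -/

/-- The ATOMIC TYPE of a `k`-tuple `v̄` of vertices of `G`: the `k × k` matrix over `{0, 1, 2}`
with entry `2` if `vᵢ = vⱼ`, `1` if `vᵢ ~ vⱼ`, `0` otherwise — the isomorphism type of the
labelled induced subgraph. [Dell–Grohe–Rattan 2018, §8; Cai–Fürer–Immerman 1992, §5 ("the
initial color W⁰(u) according to the isomorphism type of u")] [cite: DellGroheRattan2018, §8 (atomic type)] -/
def atp {k : ℕ} (G : SimpleGraph V) [DecidableEq V] [DecidableRel G.Adj] (v : Fin k → V) :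
    Fin k → Fin k → Fin 3 :=
  fun i j => if v i = v j then 2 else if G.Adj (v i) (v j) then 1 else 0

/-- DGR's "crucial property": two tuples have the same atomic type iff `{(vᵢ, wᵢ)}` is a partial
isomorphism (`IsPartialIso` of `CkEquiv.lean`, on the set of pebbled pairs).
[Dell–Grohe–Rattan 2018, §8] [folklore] -/
theorem atp_eq_atp_iff {k : ℕ} {G : SimpleGraph V} {H : SimpleGraph W} [DecidableEq V]
    [DecidableEq W] [DecidableRel G.Adj] [DecidableRel H.Adj] (v : Fin k → V) (w : Fin k → W) :
    atp G v = atp H w ↔ IsPartialIso G H (Set.range fun i => (v i, w i)) := by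
  constructor
  · intro h
    have hij : ∀ i j, (v i = v j ↔ w i = w j) ∧ (G.Adj (v i) (v j) ↔ H.Adj (w i) (w j)) := by
      intro i j
      have hh := congrFun (congrFun h i) j
      simp only [atp] at hh
      by_cases h1 : v i = v j <;> by_cases h2 : w i = w j <;>
        by_cases h3 : G.Adj (v i) (v j) <;> by_cases h4 : H.Adj (w i) (w j) <;>
        simp_all
    refine ⟨?_, ?_⟩
    · rintro _ ⟨i, rfl⟩ _ ⟨j, rfl⟩
      exact (hij i j).1
    · rintro _ ⟨i, rfl⟩ _ ⟨j, rfl⟩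
      exact (hij i j).2
  · intro h
    funext i j
    have h1 := h.eq_iff ⟨i, rfl⟩ ⟨j, rfl⟩
    have h2 := h.adj_iff ⟨i, rfl⟩ ⟨j, rfl⟩
    simp only at h1 h2
    simp only [atp]
    by_cases hv : v i = v j
    · rw [if_pos hv, if_pos (h1.1 hv)]
    · rw [if_neg hv, if_neg (fun hw => hv (h1.2 hw))]
      by_cases ha : G.Adj (v i) (v j)
      · rw [if_pos ha, if_pos (h2.1 ha)]
      · rw [if_neg ha, if_neg (fun hb => ha (h2.2 hb))]

/-- Atomic types are invariant under isomorphisms. [folklore] -/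
theorem atp_comp_iso {k : ℕ} {G : SimpleGraph V} {H : SimpleGraph W} [DecidableEq V]
    [DecidableEq W] [DecidableRel G.Adj] [DecidableRel H.Adj] (e : G ≃g H) (v : Fin k → V) :
    atp H (e ∘ v) = atp G v := by
  funext i j
  simp only [atp, Function.comp_apply, EmbeddingLike.apply_eq_iff_eq, e.map_adj_iff]

/-! ### The refinement -/

/-- The CANONICAL COLOURS of round `i` of `k`-WL: atomic types at round `0`; at round `i + 1` the
old colour together with a multiset (over the new vertex `w`) of pairs (atomic type of the
extended `(k+1)`-tuple, vector of old colours of the `k` substituted tuples). Nested multisets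
make colours of different graphs directly comparable (the "decoding tables" of CFI).
[Dell–Grohe–Rattan 2018, §8; Cai–Fürer–Immerman 1992, §5] [folklore] -/
def WLColour (k : ℕ) : ℕ → Type
  | 0 => Fin k → Fin k → Fin 3
  | i + 1 => WLColour k i × Multiset ((Fin (k + 1) → Fin (k + 1) → Fin 3) × (Fin k → WLColour k i))

/-- WL colours have decidable equality (the refinement is an algorithm: colours are finite
nested multisets). [Cai–Fürer–Immerman 1992, §5 ("we sort these new colors lexicographically")]
[folklore] -/
instance instDecidableEqWLColour (k : ℕ) : (i : ℕ) → DecidableEq (WLColour k i)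
  | 0 => inferInstanceAs (DecidableEq (Fin k → Fin k → Fin 3))
  | i + 1 =>
    letI : DecidableEq (WLColour k i) := instDecidableEqWLColour k i
    -- composed by hand: the nested search exceeds the default instance-search size
    letI : DecidableEq (Multiset ((Fin (k + 1) → Fin (k + 1) → Fin 3) × (Fin k → WLColour k i))) :=
      inferInstance
    inferInstanceAs (DecidableEq (WLColour k i ×
      Multiset ((Fin (k + 1) → Fin (k + 1) → Fin 3) × (Fin k → WLColour k i))))

/-- **The `k`-dimensional Weisfeiler–Leman colouring** `C_i^k(G; v̄)` of `k`-tuples: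
`C₀(v̄) = atp(v̄)` and
`C_{i+1}(v̄) = (C_i(v̄), {{ (atp(v̄, w), (C_i(v̄[j ↦ w]))_{j}) | w ∈ V(G) }})`.
[Dell–Grohe–Rattan 2018, §8 (display defining `C_{i+1}^k` and `M_i`); Cai–Fürer–Immerman 1992,
§5 (`sift`)] [cite: DellGroheRattan2018, §8 (k-WL)] -/
def wlColour {k : ℕ} (G : SimpleGraph V) [Fintype V] [DecidableEq V] [DecidableRel G.Adj] :
    (i : ℕ) → (Fin k → V) → WLColour k i
  | 0 => fun v => atp G v
  | i + 1 => fun v =>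
      (wlColour G i v, (Finset.univ : Finset V).val.map fun w =>
        (atp G (Fin.snoc v w : Fin (k + 1) → V), fun j => wlColour G i (Function.update v j w)))

/-- The multiset of round-`i` colours of all `k`-tuples of `G`. [Dell–Grohe–Rattan 2018, §8]
[folklore] -/
def wlColours (k : ℕ) (G : SimpleGraph V) [Fintype V] [DecidableEq V] [DecidableRel G.Adj]
    (i : ℕ) : Multiset (WLColour k i) :=
  (Finset.univ : Finset (Fin k → V)).val.map (wlColour G i)

/-- **`k`-WL EQUIVALENCE** (`k`-WL does NOT distinguish `G` and `H`): at every round the multisets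
of colours of all `k`-tuples coincide. (DGR compare the stable colourings; agreement at every
round — the form matched round by round with `≡_{C^{k+1},r}` in Cai–Fürer–Immerman's proof of
Thm 5.2 — implies it and is taken as the definition here.) [Dell–Grohe–Rattan 2018, §8 ("k-WL
distinguishes G and H"); Cai–Fürer–Immerman 1992, Thm 5.2; Dawar–Wilsenach 2025, §2.4 (`≡ₖ`)]
[cite: DellGroheRattan2018, §8 (k-WL distinguishes two graphs)] -/
def WLEquiv (k : ℕ) (G : SimpleGraph V) (H : SimpleGraph W) [Fintype V] [DecidableEq V]
    [DecidableRel G.Adj] [Fintype W] [DecidableEq W] [DecidableRel H.Adj] : Prop :=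
  ∀ i : ℕ, wlColours k G i = wlColours k H i

/-! ### Proved API -/

section API

variable {k : ℕ} {G : SimpleGraph V} {H : SimpleGraph W} [Fintype V] [DecidableEq V]
  [DecidableRel G.Adj] [Fintype W] [DecidableEq W] [DecidableRel H.Adj]

/-- WL colours are invariant under isomorphisms: `C_i(H; e ∘ v̄) = C_i(G; v̄)`. [folklore] -/
theorem wlColour_comp_iso (e : G ≃g H) : ∀ (i : ℕ) (v : Fin k → V),
    wlColour H i (e ∘ v) = wlColour G i v
  | 0, v => atp_comp_iso e v
  | i + 1, v => by
    simp only [wlColour]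
    refine Prod.ext (wlColour_comp_iso e i v) ?_
    -- reindex the multiset over `w ∈ V(H)` along `e`
    have huniv : (Finset.univ : Finset W).val = (Finset.univ : Finset V).val.map e := by
      rw [← Finset.map_univ_equiv e.toEquiv, Finset.map_val]
      rfl
    rw [huniv, Multiset.map_map]
    refine Multiset.map_congr rfl fun w _ => ?_
    simp only [Function.comp_apply]
    refine Prod.ext ?_ (funext fun j => ?_)
    · show atp H (Fin.snoc (e ∘ v) (e w) : Fin (k + 1) → W) = atp G (Fin.snoc v w)
      have : (Fin.snoc (e ∘ v) (e w) : Fin (k + 1) → W) = e ∘ Fin.snoc v w := by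
        funext l
        refine Fin.lastCases ?_ (fun l => ?_) l
        · simp
        · simp [Fin.snoc_castSucc]
      rw [this, atp_comp_iso]
    · show wlColour H i (Function.update (e ∘ v) j (e w)) = wlColour G i (Function.update v j w)
      have : Function.update (e ∘ v) j (e w) = e ∘ Function.update v j w := by
        rw [Function.comp_update]
      rw [this, wlColour_comp_iso e i]

/-- Isomorphic graphs are `k`-WL equivalent. [folklore] -/
theorem WLEquiv.of_iso (e : G ≃g H) : WLEquiv k G H := by
  intro i
  let Φ : (Fin k → V) ≃ (Fin k → W) := (Equiv.refl (Fin k)).arrowCongr e.toEquiv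
  have huniv : (Finset.univ : Finset (Fin k → W)).val =
      (Finset.univ : Finset (Fin k → V)).val.map Φ := by
    rw [← Finset.map_univ_equiv Φ, Finset.map_val]
    rfl
  simp only [wlColours]
  rw [huniv, Multiset.map_map]
  refine Multiset.map_congr rfl fun v _ => ?_
  have hΦ : (Φ v : Fin k → W) = e ∘ v := by
    funext j
    simp [Φ, Equiv.arrowCongr_apply]
  simp only [Function.comp_apply]
  rw [hΦ, wlColour_comp_iso]

/-- `k`-WL equivalence is reflexive. [folklore] -/
theorem WLEquiv.refl (k : ℕ) (G : SimpleGraph V) [DecidableRel G.Adj] : WLEquiv k G G :=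
  fun _ => rfl

/-- `k`-WL equivalence is symmetric. [folklore] -/
theorem WLEquiv.symm (h : WLEquiv k G H) : WLEquiv k H G := fun i => (h i).symm

/-- `k`-WL equivalence is transitive. [folklore] -/
theorem WLEquiv.trans {X : Type u} {K : SimpleGraph X} [Fintype X] [DecidableEq X]
    [DecidableRel K.Adj] (h₁ : WLEquiv k G H) (h₂ : WLEquiv k H K) : WLEquiv k G K :=
  fun i => (h₁ i).trans (h₂ i)

/-- For `k ≥ 1`, `k`-WL-equivalent graphs have the same number of vertices (the multisets of
round `0` have `|V|^k` elements). [folklore] -/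
theorem WLEquiv.card_eq (h : WLEquiv k G H) (hk : k ≠ 0) : Fintype.card V = Fintype.card W := by
  have h0 := congrArg Multiset.card (h 0)
  simp only [wlColours, Multiset.card_map, Finset.card_val, Finset.card_univ, Fintype.card_fun,
    Fintype.card_fin] at h0
  exact Nat.pow_left_injective hk h0

end API

/-! ### `k`-WL versus `≡_{C^{k+1}}` (named fact) -/

/-- **`k`-WL equivalence is `C^{k+1}`-equivalence** (NAMED FACT, not proved here). For `k ≥ 1` and
finite simple graphs `G` on `Fin n`, `H` on `Fin m`: `k`-WL does not distinguish `G` and `H`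
(`WLEquiv k`, agreement of the colour multisets at every round) iff `G ≡_{C^{k+1}} H`, in the
tree's game form `CkEquiv (k + 1) G H` (Duplicator wins the bijective `(k+1)`-pebble game;
Hella's theorem, `CountingLogic.lean`, identifies it with agreement on `C^{k+1}` sentences).
Printed: Dell–Grohe–Rattan 2018, Lemma 12 [Immerman–Lander 1990] ("For all k ≥ 1 and all graphs
G and H the following are equivalent: k-WL distinguishes G and H; the logic C^{k+1} distinguishes
G and H"), and Cai–Fürer–Immerman 1992, Thm 5.2 (stable colours of `k`-configurations agree iff
`≡_{C^{k+1}}` iff Player II wins the `C^{k+1}` game, proved round by round). The case `k = 0` is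
excluded as in the sources. [cite: DellGroheRattan2018, Lemma 12 (k-WL ≡ C^{k+1}, Immerman–Lander)] -/
def immermanLander_wlEquiv_iff_ckEquiv : Prop :=
  ∀ (k : ℕ), 1 ≤ k → ∀ (n m : ℕ) (G : SimpleGraph (Fin n)) (H : SimpleGraph (Fin m))
    [DecidableRel G.Adj] [DecidableRel H.Adj], WLEquiv k G H ↔ CkEquiv (k + 1) G H

end Literature.ModelTheory.FiniteModelTheory
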